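import Mathlib
import Literature.LinearAlgebra.Matrix.PermanentLaplace
import Summits.ValiantsHypothesis.ValiantsHypothesis.Theses.PrincipalMinorColouring

/-!
# Heredity of principal-minor representations of the permanent
(route `PrincipalMinorColouring`, item stmt-ValiantsHypothesis-3781 `Heredity`)

A *principal-minor representation* of `per_{n+1}` of size `R` with colouring `κ : [R] → [n+1]²` is
an identity `per_{n+1}(x + J) = (n+1)! · det(1 + diag(x ∘ κ) · K)` with `K ∈ ℂ^{R × R}`.
Freezing the last row of `x + J` at `(0, …, 0, 1)` and the rest of the last column at `0`
(i.e. substituting `x_(last,j) ↦ -1`, `x_(i,last) ↦ -1`, `x_(last,last) ↦ 0`) turns the left side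
into `per_n(x' + J)` (Laplace expansion along the last row) and the right side into
`(n+1)! · det(1 + D · K)` where the diagonal matrix `D` carries the variables `x'` on the positions
`S = κ⁻¹([n]²)` and the constants `-1, 0` on the complement `U`.  The `U`-block `1 + D_U K_UU` is a
constant matrix of determinant `n!/(n+1)!` (compare constant coefficients), hence invertible, and
the Schur complement by it (`Matrix.det_fromBlocks₂₂`) gives
`per_n(x' + J) = n! · det(1 + diag(x' ∘ κ') · K')` with
`K' = K_SS - K_SU (1 + D_U K_UU)⁻¹ D_U K_US ∈ ℂ^{S × S}` and `κ' = κ|_S`; colour classes do not grow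
and `|S| ≤ R`.  This is the conditioning step of Ikenmeyer–Landsberg 2017, Lemma 6.2 /
Aravind–Joglekar 2015 (read-k heredity), in the principal-minor normal form.

The block algebra is written for an arbitrary splitting `h : ι ≃ S ⊕ U` of the index type with
its two legs `eS : S → ι`, `eU : U → ι`; the item uses `S = {i // p i}`, `U = {i // ¬ p i}`,
`h = (Equiv.sumCompl p).symm` and `eS = eU = Subtype.val`.
-/

set_option linter.dupNamespace false

namespace Summit.ValiantsHypothesis.ValiantsHypothesis.Theorems

open MvPolynomial Matrix
open Literature.Computability.AlgebraicComplexity (perPoly)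

/-! ### Block algebra for `1 + diagonal d * K` along a splitting `ι ≃ S ⊕ U` -/

section BlockAlgebra

variable {A : Type*} [CommRing A] {ι S U : Type*} [Fintype ι] [DecidableEq ι] [Fintype S]
  [DecidableEq S] [Fintype U] [DecidableEq U] (h : ι ≃ S ⊕ U) (eS : S → ι) (eU : U → ι)
  (hS : ∀ s, h.symm (Sum.inl s) = eS s) (hU : ∀ u, h.symm (Sum.inr u) = eU u)
include hS hU

/-- Re-indexing `1 + diagonal d * K` along `h : ι ≃ S ⊕ U` exhibits the four blocks
`1 + D_S K_SS`, `D_S K_SU`, `D_U K_US`, `1 + D_U K_UU`. [folklore] -/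
theorem heredity_reindex_one_add_diagonal_mul (d : ι → A) (K : Matrix ι ι A) :
    Matrix.reindex h h (1 + Matrix.diagonal d * K) =
      Matrix.fromBlocks
        (1 + Matrix.diagonal (fun s => d (eS s)) * K.submatrix eS eS)
        (Matrix.diagonal (fun s => d (eS s)) * K.submatrix eS eU)
        (Matrix.diagonal (fun u => d (eU u)) * K.submatrix eU eS)
        (1 + Matrix.diagonal (fun u => d (eU u)) * K.submatrix eU eU) := by
  have hinjS : Function.Injective eS := fun s s' hss' =>
    Sum.inl_injective (h.symm.injective (by rw [hS, hS, hss']))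
  have hinjU : Function.Injective eU := fun u u' huu' =>
    Sum.inr_injective (h.symm.injective (by rw [hU, hU, huu']))
  have hne : ∀ s u, eS s ≠ eU u := fun s u hsu =>
    Sum.inl_ne_inr (h.symm.injective (by rw [hS, hU, hsu]))
  have hne' : ∀ u s, eU u ≠ eS s := fun u s hus => (hne s u hus.symm).elim
  ext (s | u) (s' | u')
  · simp [Matrix.one_apply, hS, hinjS.eq_iff]
  · simp [hS, hU, hne]
  · simp [hS, hU, hne']
  · simp [Matrix.one_apply, hU, hinjU.eq_iff]

/-- If the variables on `S` vanish and are the constants `c` on `U`, then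
`det (1 + diagonal d * K)` is the determinant of the `U`-block `1 + diagonal c * K_UU`.
[folklore] -/
theorem heredity_det_of_zero_on (d : ι → A) (K : Matrix ι ι A) (c : U → A)
    (h0 : ∀ s, d (eS s) = 0) (hc : ∀ u, d (eU u) = c u) :
    (1 + Matrix.diagonal d * K).det = (1 + Matrix.diagonal c * K.submatrix eU eU).det := by
  rw [← Matrix.det_reindex_self h, heredity_reindex_one_add_diagonal_mul h eS eU hS hU]
  have hD : (Matrix.diagonal fun s => d (eS s)) = 0 := by
    ext s s'
    simp [Matrix.diagonal_apply, h0 s]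
  have hdU : (fun u => d (eU u)) = c := funext hc
  rw [hD, hdU, Matrix.zero_mul, Matrix.zero_mul, add_zero, Matrix.det_fromBlocks_zero₁₂,
    Matrix.det_one, one_mul]

/-- **Schur-complement conditioning.** If the `U`-block `M_U = 1 + D_U K_UU` has a right inverse
`E`, then `det (1 + diagonal d * K) = det M_U · det (1 + D_S (K_SS - K_SU E D_U K_US))`.
[folklore] -/
theorem heredity_det_one_add_diagonal_mul (d : ι → A) (K : Matrix ι ι A) (E : Matrix U U A)
    (hE : (1 + Matrix.diagonal (fun u => d (eU u)) * K.submatrix eU eU) * E = 1) :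
    (1 + Matrix.diagonal d * K).det =
      (1 + Matrix.diagonal (fun u => d (eU u)) * K.submatrix eU eU).det *
        (1 + Matrix.diagonal (fun s => d (eS s)) * (K.submatrix eS eS - K.submatrix eS eU * E *
          (Matrix.diagonal (fun u => d (eU u)) * K.submatrix eU eS))).det := by
  letI : Invertible (1 + Matrix.diagonal (fun u => d (eU u)) * K.submatrix eU eU) :=
    invertibleOfRightInverse _ _ hE
  have hinv : ⅟(1 + Matrix.diagonal (fun u => d (eU u)) * K.submatrix eU eU) = E :=
    invOf_eq_right_inv hE
  rw [← Matrix.det_reindex_self h, heredity_reindex_one_add_diagonal_mul h eS eU hS hU,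
    Matrix.det_fromBlocks₂₂, hinv]
  congr 2
  simp only [Matrix.mul_sub, Matrix.mul_assoc, add_sub_assoc]

/-- Conditioning with a scalar matrix `K.map f` (`f : k →+* A`), variables `x` on `S` and
constants `f ∘ c` on `U`: `det (1 + diagonal d * K.map f) = f (det M_U) · det (1 + diagonal x *
K'.map f)` with `M_U = 1 + diagonal c * K_UU` (assumed to have the right inverse `E` over `k`)
and `K' = K_SS - K_SU E (diagonal c) K_US`. [folklore] -/
theorem heredity_det_map {k : Type*} [CommRing k] (f : k →+* A) (K : Matrix ι ι k) (d : ι → A)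
    (x : S → A) (c : U → k) (hx : ∀ s, d (eS s) = x s) (hc : ∀ u, d (eU u) = f (c u))
    (E : Matrix U U k) (hE : (1 + Matrix.diagonal c * K.submatrix eU eU) * E = 1) :
    (1 + Matrix.diagonal d * K.map f).det =
      f (1 + Matrix.diagonal c * K.submatrix eU eU).det *
        (1 + Matrix.diagonal x * (K.submatrix eS eS - K.submatrix eS eU * E *
          (Matrix.diagonal c * K.submatrix eU eS)).map f).det := by
  have hdU : (fun u => d (eU u)) = f ∘ c := funext hc
  have hdS : (fun s => d (eS s)) = x := funext hx
  have hMU : 1 + Matrix.diagonal (fun u => d (eU u)) * (K.map f).submatrix eU eU =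
      (1 + Matrix.diagonal c * K.submatrix eU eU).map f := by
    rw [hdU, Matrix.map_add f (map_add f), Matrix.map_one f (map_zero f) (map_one f),
      Matrix.map_mul, Matrix.diagonal_map (map_zero f), Matrix.submatrix_map]
    rfl
  have hE' : (1 + Matrix.diagonal (fun u => d (eU u)) * (K.map f).submatrix eU eU) * E.map f =
      1 := by
    rw [hMU, ← Matrix.map_mul, hE, Matrix.map_one f (map_zero f) (map_one f)]
  rw [heredity_det_one_add_diagonal_mul h eS eU hS hU d (K.map f) (E.map f) hE', hMU,
    ← RingHom.mapMatrix_apply, ← RingHom.map_det]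
  congr 2
  rw [hdS, hdU, Matrix.map_sub f (map_sub f), Matrix.map_mul, Matrix.map_mul, Matrix.map_mul,
    Matrix.diagonal_map (map_zero f), Matrix.submatrix_map, Matrix.submatrix_map,
    Matrix.submatrix_map]
  rfl

end BlockAlgebra

/-! ### Permanents: substitution and expansion along the last row -/

section Permanent

/-- `aeval f PER = per (f (i, j))ᵢⱼ` (the `aeval` form of `eval_perPoly`). [folklore] -/
theorem heredity_aeval_perPoly {m : Type*} [Fintype m] [DecidableEq m] {k B : Type*} [CommRing k]
    [CommRing B] [Algebra k B] (f : m × m → B) :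
    aeval f (perPoly m k) = (Matrix.of fun i j => f (i, j)).permanent := by
  simp [Literature.Computability.AlgebraicComplexity.perPoly, Matrix.permanent, map_sum, map_prod,
    Matrix.mvPolynomialX]

/-- A matrix whose last row is `(0, …, 0, 1)` has the permanent of its top-left block (Laplace
expansion along the last row, `Matrix.permanent_eq_sum_row`). [folklore] -/
theorem heredity_permanent_last_row {B : Type*} [CommRing B] {n : ℕ}
    (N : Matrix (Fin (n + 1)) (Fin (n + 1)) B) (hrow : ∀ j : Fin n, N (Fin.last n) j.castSucc = 0)
    (hcorner : N (Fin.last n) (Fin.last n) = 1) :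
    N.permanent = (N.submatrix Fin.castSucc Fin.castSucc).permanent := by
  rw [Matrix.permanent_eq_sum_row N (Fin.last n), Fin.sum_univ_castSucc]
  simp [hrow, hcorner, Fin.succAbove_last]

/-- The conditioning substitution `g` (last row of `x + J` frozen at `(0, …, 0, 1)`, interior
variables kept) sends `per_{n+1}(x + J)` to `per_n(x' + J)`. [folklore] -/
theorem heredity_lhs (n : ℕ) (g : Fin (n + 1) × Fin (n + 1) → MvPolynomial (Fin n × Fin n) ℂ)
    (hrow : ∀ j : Fin n, g (Fin.last n, j.castSucc) = -1)
    (hcorner : g (Fin.last n, Fin.last n) = 0)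
    (hint : ∀ i j : Fin n, g (i.castSucc, j.castSucc) = X (i, j)) :
    aeval g (aeval (fun e => (X e : MvPolynomial (Fin (n + 1) × Fin (n + 1)) ℂ) + 1)
        (perPoly (Fin (n + 1)) ℂ)) =
      aeval (fun e => (X e : MvPolynomial (Fin n × Fin n) ℂ) + 1) (perPoly (Fin n) ℂ) := by
  rw [comp_aeval_apply, heredity_aeval_perPoly, heredity_aeval_perPoly,
    heredity_permanent_last_row]
  · congr 1
    ext i j
    simp [hint]
  · intro j
    simp [hrow]
  · simp [hcorner]

/-- A `ℂ`-algebra map `φ` acts on `a · det(1 + diagonal v · K)` (`K` a scalar matrix) through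
the diagonal only. [folklore] -/
theorem heredity_rhs {σ B : Type*} [CommRing B] [Algebra ℂ B] {R : ℕ}
    (φ : MvPolynomial σ ℂ →ₐ[ℂ] B) (a : ℂ) (K : Matrix (Fin R) (Fin R) ℂ)
    (v : Fin R → MvPolynomial σ ℂ) :
    φ (C a * (1 + Matrix.diagonal v * K.map (fun b : ℂ => (C b : MvPolynomial σ ℂ))).det) =
      algebraMap ℂ B a *
        (1 + Matrix.diagonal (fun i => φ (v i)) * K.map (algebraMap ℂ B)).det := by
  have hC : ∀ b : ℂ, φ (C b) = algebraMap ℂ B b := fun b => by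
    rw [← MvPolynomial.algebraMap_eq]
    exact φ.commutes b
  rw [map_mul, hC, AlgHom.map_det, AlgHom.mapMatrix_apply, Matrix.map_add _ (map_add φ),
    Matrix.map_one _ (map_zero φ) (map_one φ), Matrix.map_mul, Matrix.diagonal_map (map_zero φ),
    Matrix.map_map]
  congr
  funext b
  exact hC b

/-- The constant coefficient of `per_n(x + J)` is `per_n(J) = n!`. [folklore] -/
theorem heredity_aeval_zero_lhs (n : ℕ) :
    aeval (fun _ : Fin n × Fin n => (0 : ℂ))
        (aeval (fun e => (X e : MvPolynomial (Fin n × Fin n) ℂ) + 1) (perPoly (Fin n) ℂ)) =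
      (n.factorial : ℂ) := by
  rw [comp_aeval_apply, heredity_aeval_perPoly]
  simp [Matrix.permanent, Fintype.card_perm]

/-- Transport of a principal-minor determinant along an equivalence `Fin m ≃ S` of index types.
[folklore] -/
theorem heredity_transport {S τ : Type*} [Fintype S] [DecidableEq S] {m : ℕ} (e : Fin m ≃ S)
    (K' : Matrix S S ℂ) (κ' : S → τ) :
    (1 + Matrix.diagonal (fun j : Fin m => (X (κ' (e j)) : MvPolynomial τ ℂ)) *
        (K'.submatrix e e).map (fun b : ℂ => (C b : MvPolynomial τ ℂ))).det =
      (1 + Matrix.diagonal (fun s => (X (κ' s) : MvPolynomial τ ℂ)) *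
        K'.map (fun b : ℂ => (C b : MvPolynomial τ ℂ))).det := by
  rw [← Matrix.det_submatrix_equiv_self e
    (1 + Matrix.diagonal (fun s => (X (κ' s) : MvPolynomial τ ℂ)) * K'.map _)]
  congr 1
  ext i j
  simp [Matrix.one_apply]

end Permanent

/-! ### The core: Schur complement by the frozen block -/

section Core

variable {R : ℕ} {S U : Type*} [Fintype S] [DecidableEq S] [Fintype U] [DecidableEq U]
  (h : Fin R ≃ S ⊕ U) (eS : S → Fin R) (eU : U → Fin R)
  (hS : ∀ s, h.symm (Sum.inl s) = eS s) (hU : ∀ u, h.symm (Sum.inr u) = eU u)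
include hS hU

/-- **Core of heredity.** After the conditioning substitution `g` (variables `X ∘ κ'` on the
positions `eS : S → [R]`, constants `c` on the complementary positions `eU : U → [R]`), a size-`R`
representation of `per_{n+1}` that has become `per_n(x' + J) = (n+1)! · det(1 + diag(g ∘ κ) · K)`
is a representation `per_n(x' + J) = n! · det(1 + diag(X ∘ κ') · K')` indexed by `S`, with
`K' = K_SS - K_SU (1 + diag(c) K_UU)⁻¹ diag(c) K_US`; the frozen block is invertible because the
constant coefficients give `n! = (n+1)! · det(1 + diag(c) K_UU)`. [folklore] -/
theorem heredity_core {n : ℕ} (K : Matrix (Fin R) (Fin R) ℂ)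
    (κ : Fin R → Fin (n + 1) × Fin (n + 1))
    (g : Fin (n + 1) × Fin (n + 1) → MvPolynomial (Fin n × Fin n) ℂ) (κ' : S → Fin n × Fin n)
    (c : U → ℂ) (hx : ∀ s, g (κ (eS s)) = X (κ' s)) (hc : ∀ u, g (κ (eU u)) = C (c u))
    (h1 : aeval (fun e => X e + 1) (perPoly (Fin n) ℂ) =
      C ((n + 1).factorial : ℂ) * (1 + Matrix.diagonal (fun i => g (κ i)) *
        K.map (C : ℂ →+* MvPolynomial (Fin n × Fin n) ℂ)).det) :
    ∃ K' : Matrix S S ℂ,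
      aeval (fun e => X e + 1) (perPoly (Fin n) ℂ) =
        C (n.factorial : ℂ) * (1 + Matrix.diagonal (fun s => X (κ' s)) *
          K'.map (fun b : ℂ => (C b : MvPolynomial (Fin n × Fin n) ℂ))).det := by
  -- the frozen block
  obtain ⟨MU, hMU⟩ : ∃ MU : Matrix U U ℂ, MU = 1 + Matrix.diagonal c * K.submatrix eU eU :=
    ⟨_, rfl⟩
  -- constant coefficients: `n! = (n+1)! · det MU`
  have hKid : K.map (algebraMap ℂ ℂ) = K := by
    ext
    simp
  have h0 := congrArg (aeval (fun _ : Fin n × Fin n => (0 : ℂ))) h1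
  rw [heredity_aeval_zero_lhs, heredity_rhs (aeval fun _ : Fin n × Fin n => (0 : ℂ)), hKid,
    Algebra.algebraMap_self_apply,
    heredity_det_of_zero_on h eS eU hS hU
      (fun i => aeval (fun _ : Fin n × Fin n => (0 : ℂ)) (g (κ i))) K c (fun s => by simp [hx s])
      (fun u => by simp [hc u]), ← hMU] at h0
  -- hence `MU` is invertible
  have hMUdet : MU.det ≠ 0 := by
    intro hdet
    rw [hdet, mul_zero, Nat.cast_eq_zero] at h0
    exact Nat.factorial_ne_zero n h0
  have hE : (1 + Matrix.diagonal c * K.submatrix eU eU) * MU⁻¹ = 1 := by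
    rw [← hMU]
    exact Matrix.mul_nonsing_inv MU (isUnit_iff_ne_zero.mpr hMUdet)
  -- Schur complement
  refine ⟨K.submatrix eS eS - K.submatrix eS eU * MU⁻¹ * (Matrix.diagonal c * K.submatrix eU eS),
    ?_⟩
  rw [h1, heredity_det_map h eS eU hS hU C K (fun i => g (κ i)) (fun s => X (κ' s)) c hx hc MU⁻¹
    hE, ← hMU, ← mul_assoc, ← map_mul, ← h0]

end Core

/-! ### The route item -/

/-- **Heredity** (route `PrincipalMinorColouring`, item stmt-ValiantsHypothesis-3781): a
principal-minor representation `per_{n+1}(x + J) = (n+1)! · det(1 + diag(x ∘ κ) K)` with colour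
classes of size `≤ r` yields one of `per_n(x + J)` with classes `≤ r` and no larger size — freeze
the last row of `x + J` at `(0, …, 0, 1)` (and the rest of the last column at `0`) and take the
Schur complement by the frozen block (`heredity_core`); this is the conditioning step of
Ikenmeyer–Landsberg 2017, Lemma 6.2, in the principal-minor normal form. -/
theorem heredity_proof :
    Summit.ValiantsHypothesis.ValiantsHypothesis.Theses.PrincipalMinorColouring.Heredity := by
  unfold Summit.ValiantsHypothesis.ValiantsHypothesis.Theses.PrincipalMinorColouring.Heredity
  intro n r R K κ hκ hrepr
  -- the conditioning substitution
  obtain ⟨g, hg⟩ : ∃ g : Fin (n + 1) × Fin (n + 1) → MvPolynomial (Fin n × Fin n) ℂ, ∀ e, g e =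
      if h : e.1 ≠ Fin.last n ∧ e.2 ≠ Fin.last n then X (e.1.castPred h.1, e.2.castPred h.2)
      else if e.1 = Fin.last n ∧ e.2 = Fin.last n then 0 else -1 := ⟨_, fun _ => rfl⟩
  have hrow : ∀ j : Fin n, g (Fin.last n, j.castSucc) = -1 := fun j => by
    rw [hg]
    simp [Fin.castSucc_ne_last]
  have hcorner : g (Fin.last n, Fin.last n) = 0 := by
    rw [hg]
    simp
  have hint : ∀ i j : Fin n, g (i.castSucc, j.castSucc) = X (i, j) := fun i j => by
    rw [hg, dif_pos ⟨Fin.castSucc_ne_last i, Fin.castSucc_ne_last j⟩]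
    simp
  have h1 := congrArg (aeval g) hrepr
  rw [heredity_lhs n g hrow hcorner hint, heredity_rhs, MvPolynomial.algebraMap_eq] at h1
  simp only [MvPolynomial.aeval_X] at h1
  -- the surviving positions `S = κ⁻¹([n]²)` and the frozen constants
  obtain ⟨p, hp⟩ : ∃ p : Fin R → Prop, ∀ i, p i ↔ ((κ i).1 ≠ Fin.last n ∧ (κ i).2 ≠ Fin.last n) :=
    ⟨_, fun _ => Iff.rfl⟩
  haveI : DecidablePred p := fun i => decidable_of_iff _ (hp i).symm
  obtain ⟨κ', hκ'⟩ : ∃ κ' : {i // p i} → Fin n × Fin n, ∀ s, κ' s =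
      ((κ s).1.castPred ((hp s).1 s.2).1, (κ s).2.castPred ((hp s).1 s.2).2) := ⟨_, fun _ => rfl⟩
  obtain ⟨c, hc_def⟩ : ∃ c : {i // ¬ p i} → ℂ, ∀ u, c u =
      if (κ u).1 = Fin.last n ∧ (κ u).2 = Fin.last n then 0 else -1 := ⟨_, fun _ => rfl⟩
  have hx : ∀ s : {i // p i}, g (κ s) = X (κ' s) := fun s => by
    rw [hg, dif_pos ((hp s).1 s.2), hκ']
  have hc : ∀ u : {i // ¬ p i}, g (κ u) = C (c u) := fun u => by
    rw [hg, dif_neg (fun h => u.2 ((hp u).2 h)), hc_def]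
    split_ifs <;> simp
  obtain ⟨K', hK'⟩ := heredity_core (Equiv.sumCompl p).symm Subtype.val Subtype.val (by simp)
    (by simp) K κ g κ' c hx hc h1
  -- transport to `Fin R'`
  obtain ⟨e⟩ : Nonempty (Fin (Fintype.card {i // p i}) ≃ {i // p i}) :=
    ⟨(Fintype.equivFin _).symm⟩
  refine ⟨Fintype.card {i // p i}, (Fintype.card_subtype_le p).trans_eq (Fintype.card_fin R),
    K'.submatrix e e, fun j => κ' (e j), fun e0 => ?_, ?_⟩
  · refine le_trans ?_ (hκ (e0.1.castSucc, e0.2.castSucc))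
    refine Finset.card_le_card_of_injOn (fun j => ((e j : {i // p i}) : Fin R)) ?_ ?_
    · intro j hj
      rw [Finset.mem_coe, Finset.mem_filter] at hj ⊢
      refine ⟨Finset.mem_univ _, ?_⟩
      beta_reduce at hj ⊢
      rw [← hj.2, hκ']
      simp
    · intro j _ j' _ hjj'
      exact e.injective (Subtype.val_injective hjj')
  · beta_reduce
    rw [heredity_transport e K' κ']
    exact hK'

end Summit.ValiantsHypothesis.ValiantsHypothesis.Theorems
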